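import Literature.NumberTheory.IwasawaTheory.FukudaCountingLemmas
import Literature.NumberTheory.NumberFields.HilbertClassFieldElementary
import HarnessLib

/-!
# Fukuda's Theorem 1 (2) at finite level — the class-field-theoretic RANK counting lemmas
# (`[G : G'·⟨inertia⟩·G^p] ∣ [Cl_M : Cl_M^p]` and the maximal unramified elementary abelian `p`-extension in any `Ω ⊇ M`)

Topic `NumberTheory/IwasawaTheory` (namespace = path for §2; §1 lives in `Literature.NumberTheory.NumberFields` next to its siblings).
THEOREM-ONLY file (no definition, no named fact, no `sorry`), written by the prover seat `bsd-potss-k8t-c4` g20 (cell `bsd-potss`; Fukuda road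
of stmt-BirchSwinnertonDyer-19982; closes nothing). Rank companions of brick (C) `FukudaCountingLemmas.lean` for the finite-level proof of
`fukuda1994_thm1_classGroupPRank_const_of_succ_eq` (`ClassicalMuInvariant.lean` §5): where brick (C) counts `[G : N] ∣ h(M)` for the subgroup
`N = G'·⟨I(𝔔)⟩` of a Galois group `G = Gal(E/M)`, here we count the elementary-abelian shadow `[G : N·G^p] ∣ [Cl_M : Cl_M^p] = p^{rank_p Cl_M}`.

* §1 `finrank_dvd_index_range_pow_of_pow_eq_one` — Cox Cor. 5.24 + Lang Ch. 13 §2 («`G ≈ C/C^p`») for an ABSTRACT abelian extension `E/K`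
  unramified at all places whose Galois group is killed by `p`: `[E : K] ∣ [Cl_K : Cl_K^p]`; `index_range_powMonoidHom_eq_prime_pow` —
  `[Cl_K : Cl_K^p]` is a power of `p`; `exists_intermediateField_pElementary` — the class field of `Cl_K^p` realised in any algebraically closed
  `Ω ⊇ K` (abelian, unramified at all places, Galois group killed by `p`, degree `[Cl_K : Cl_K^p]`).
* §2 `index_sup_pow_dvd_index_range_pow` — for `E/M` Galois unramified at ∞ and `N ◁ G` containing `G'` and all inertia groups:
  `[G : N·⟨σ^p⟩] ∣ [Cl_M : Cl_M^p]`.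

References: [Cox2013] §5.C Cor. 5.24; [Lang1990] Ch. 13 §2 (proof of Thm. 2.1); [Washington1997] §13.3 Lemma 13.15, Prop. 13.22/13.23;
[Fukuda1994] Thm. 1 (2), p. 264.
-/

noncomputable section

open scoped NumberField
open NumberField IsDedekindDomain Field IntermediateField

/-! ## §1 Abelian extensions killed by `p` and the elementary `p`-class field -/

namespace Literature.NumberTheory.NumberFields

variable {K : Type} [Field K] [NumberField K]

/-- **`[E : K] ∣ [Cl_K : Cl_K^p]`** for a finite ABELIAN extension `E/K`, unramified at every finite prime and at the infinite places, whose
Galois group is killed by `p` (Cox Cor. 5.24: `E ≅ M_S` with `Gal(E/K) ≅ Cl_K/S`; exponent `p` forces `Cl_K^p ≤ S`).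
[cite: Cox2013, §5.C Cor. 5.24] [cite: Lang1990, Ch. 13 §2, Thm. 2.1 (proof: «`G ≈ C(p)`»)] -/
theorem finrank_dvd_index_range_pow_of_pow_eq_one (E : Type*) [Field E] [NumberField E]
    [Algebra K E] [IsAbelianGalois K E] [IsUnramifiedAtInfinitePlaces K E]
    (hunr : ∀ v : HeightOneSpectrum (𝓞 K), Algebra.IsUnramifiedIn (𝓞 E) v.asIdeal) (p : ℕ)
    (hexp : ∀ σ : E ≃ₐ[K] E, σ ^ p = 1) :
    Module.finrank K E ∣ (powMonoidHom p : ClassGroup (𝓞 K) →* ClassGroup (𝓞 K)).range.index := by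
  classical
  haveI : Algebra.IsAlgebraic K E := Algebra.IsAlgebraic.of_finite K E
  let ι : E →ₐ[K] AlgebraicClosure K := IsAlgClosed.lift
  let E' : IntermediateField K (AlgebraicClosure K) := ι.fieldRange
  let e : E ≃ₐ[K] E' := AlgEquiv.ofInjectiveField ι
  haveI : FiniteDimensional K E' := LinearEquiv.finiteDimensional e.toLinearEquiv
  haveI : IsAbelianGalois K E' := IsAbelianGalois.of_algHom e.symm.toAlgHom
  haveI : NumberField E' := NumberField.of_module_finite K E'
  haveI : IsUnramifiedAtInfinitePlaces K E' := isUnramifiedAtInfinitePlaces_of_algHom e.symm.toAlgHom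
  have hunr' := forall_isUnramifiedIn_of_algHom e.symm.toAlgHom hunr
  obtain ⟨S, hS⟩ := hilbertClassField.exists_eq_classFieldOfSubgroup K E' hunr'
  -- `E ≃ M_S` over `K`
  let e' : E ≃ₐ[K] hilbertClassField.classFieldOfSubgroup K S := e.trans (IntermediateField.equivOfEq hS)
  have hdeg : Module.finrank K E = S.index := by
    rw [e'.toLinearEquiv.finrank_eq, hilbertClassField.finrank_classFieldOfSubgroup]
  -- the Galois group of `M_S` is killed by `p`
  have hexp' : ∀ τ : hilbertClassField.classFieldOfSubgroup K S ≃ₐ[K] hilbertClassField.classFieldOfSubgroup K S, τ ^ p = 1 := by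
    intro τ
    obtain ⟨σ, rfl⟩ := (AlgEquiv.autCongr e').surjective τ
    rw [← map_pow, hexp, map_one]
  -- `Cl/S ≅ Gal(M_S/K)` is killed by `p`, so `Cl^p ≤ S`
  obtain ⟨eS, -⟩ := hilbertClassField.exists_quotient_mulEquiv_gal K S
  have hle : (powMonoidHom p : ClassGroup (𝓞 K) →* ClassGroup (𝓞 K)).range ≤ S := by
    rintro _ ⟨c, rfl⟩
    rw [powMonoidHom_apply, ← QuotientGroup.eq_one_iff, QuotientGroup.mk_pow]
    apply eS.injective
    rw [map_pow, hexp', map_one]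
  rw [hdeg]
  exact Subgroup.index_dvd_of_le hle

/-- **`[Cl_K : Cl_K^p]` is a power of `p`** (the quotient `Cl_K/Cl_K^p` is killed by `p`). [folklore]
[cite: Lang1990, Ch. 13 §2 (`C(p) = C/C^p`, an `𝔽_p`-space of dimension `rank_p C`)] -/
theorem index_range_powMonoidHom_eq_prime_pow (p : ℕ) [hp : Fact p.Prime] :
    ∃ c : ℕ, (powMonoidHom p : ClassGroup (𝓞 K) →* ClassGroup (𝓞 K)).range.index = p ^ c := by
  have hP : IsPGroup p (ClassGroup (𝓞 K) ⧸ (powMonoidHom p : ClassGroup (𝓞 K) →* ClassGroup (𝓞 K)).range) := by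
    intro q
    obtain ⟨c, rfl⟩ := QuotientGroup.mk_surjective q
    refine ⟨1, ?_⟩
    rw [pow_one, ← QuotientGroup.mk_pow, QuotientGroup.eq_one_iff]
    exact ⟨c, rfl⟩
  obtain ⟨c, hc⟩ := IsPGroup.iff_card.mp hP
  exact ⟨c, by rw [Subgroup.index_eq_card, hc]⟩

/-- **The maximal unramified elementary abelian `p`-extension realised inside any algebraically closed field over `K`.** For a number
field `K`, a prime `p` and an algebraically closed `Ω ⊇ K` (algebraic over `K`), there is an intermediate field `P/K` of `Ω`, finite ABELIAN
over `K`, UNRAMIFIED at every finite prime and at the infinite places, with `Gal(P/K)` killed by `p` and `[P : K] = [Cl_K : Cl_K^p]`: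
the class field of `Cl_K^p` (`HilbertClassFieldElementary`), transported along a `K`-embedding `\bar K → Ω`.
[cite: Lang1990, Ch. 13 §2, Thm. 2.1 (proof: «`G ≈ C(p)`»)] [cite: Cox2013, §5.C Cor. 5.24] -/
theorem exists_intermediateField_pElementary (K : Type) [Field K] [NumberField K] (p : ℕ)
    (Ω' : Type*) [Field Ω'] [Algebra K Ω'] [IsAlgClosed Ω'] [Algebra.IsAlgebraic K Ω'] :
    ∃ (P : IntermediateField K Ω') (_ : FiniteDimensional K P),
      IsAbelianGalois K P ∧ IsUnramifiedAtInfinitePlaces K P ∧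
        (∀ v : HeightOneSpectrum (𝓞 K), Algebra.IsUnramifiedIn (𝓞 P) v.asIdeal) ∧
          (∀ σ : P ≃ₐ[K] P, σ ^ p = 1) ∧
            Module.finrank K P = (powMonoidHom p : ClassGroup (𝓞 K) →* ClassGroup (𝓞 K)).range.index := by
  classical
  set P₀ := hilbertClassField.classFieldOfSubgroup K (powMonoidHom p : ClassGroup (𝓞 K) →* ClassGroup (𝓞 K)).range with hP₀
  haveI : NumberField P₀ := NumberField.of_module_finite K P₀
  have hP₀deg : Module.finrank K P₀ = (powMonoidHom p : ClassGroup (𝓞 K) →* ClassGroup (𝓞 K)).range.index :=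
    hilbertClassField.finrank_classFieldOfSubgroup K _
  have hP₀exp : ∀ σ : P₀ ≃ₐ[K] P₀, σ ^ p = 1 := hilbertClassField.pow_eq_one_of_mem_gal_classFieldOfSubgroup_pow K p
  have hP₀unr : ∀ v : HeightOneSpectrum (𝓞 K), Algebra.IsUnramifiedIn (𝓞 P₀) v.asIdeal :=
    hilbertClassField.classFieldOfSubgroup_isUnramifiedIn K _
  -- transport along `\bar K → Ω'`
  let ψ : AlgebraicClosure K →ₐ[K] Ω' := IsAlgClosed.lift
  set P : IntermediateField K Ω' := P₀.map ψ with hP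
  let e : P₀ ≃ₐ[K] P := IntermediateField.equivMap P₀ ψ
  haveI hPfd : FiniteDimensional K P := LinearEquiv.finiteDimensional e.toLinearEquiv
  haveI : NumberField P := NumberField.of_module_finite K P
  refine ⟨P, hPfd, IsAbelianGalois.of_algHom (e.symm : P →ₐ[K] P₀), isUnramifiedAtInfinitePlaces_of_algHom (e.symm : P →ₐ[K] P₀),
    forall_isUnramifiedIn_of_algHom (e.symm : P →ₐ[K] P₀) hP₀unr, ?_, ?_⟩
  · intro σ
    obtain ⟨τ, rfl⟩ := (AlgEquiv.autCongr e).surjective σ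
    rw [← map_pow, hP₀exp, map_one]
  · rw [← e.toLinearEquiv.finrank_eq, hP₀deg]

end Literature.NumberTheory.NumberFields

/-! ## §2 `[G : G'·⟨inertia⟩·G^p] ∣ [Cl_M : Cl_M^p]` for a finite Galois extension unramified at infinity -/

namespace Literature.NumberTheory.NumberFields

open scoped Pointwise

/-- A subgroup containing the commutator subgroup is normal. [folklore] -/
private theorem normal_of_commutator_le'' {G : Type*} [Group G] {N : Subgroup G} (h : ⁅(⊤ : Subgroup G), ⊤⁆ ≤ N) :
    N.Normal :=
  ⟨fun m hm g => by
    have h2 := Subgroup.commutator_mem_commutator (Subgroup.mem_top g) (Subgroup.mem_top m)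
    rw [commutatorElement_def] at h2
    have h1 : g * m * g⁻¹ = g * m * g⁻¹ * m⁻¹ * m := by group
    rw [h1]
    exact mul_mem (h h2) hm⟩

/-- **`[G : N·G^p] ∣ [Cl_M : Cl_M^p]`.** Let `E/M` be a finite Galois extension of number fields unramified at the infinite places,
`G = Gal(E/M)`, and `N ≤ G` a subgroup containing the commutator subgroup and the inertia group of every prime of `E`. Then the subgroup
`N' = N·⟨σ^p : σ ∈ G⟩` has `[G : N'] ∣ [Cl_M : Cl_M^p]`: its fixed field is abelian over `M`, unramified at all places, with Galois group
`G/N'` killed by `p` (§1). The elementary-abelian shadow of brick (C) `index_dvd_classNumber_of_commutator_le_of_inertia_le`.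
[cite: Washington1997, §13.3 Lemma 13.15 and Prop. 13.23 (proof: `rank A_n` via the maximal unramified elementary abelian `p`-extension)]
[cite: Cox2013, §5.C Cor. 5.24] -/
theorem index_sup_pow_dvd_index_range_pow (M E : Type) [Field M] [NumberField M] [Field E]
    [NumberField E] [Algebra M E] [IsGalois M E] [IsUnramifiedAtInfinitePlaces M E] (N : Subgroup (E ≃ₐ[M] E))
    (hcomm : ⁅(⊤ : Subgroup (E ≃ₐ[M] E)), ⊤⁆ ≤ N)
    (hIN : ∀ (Q : Ideal (𝓞 E)) [Q.IsMaximal], Q.inertia (E ≃ₐ[M] E) ≤ N) (p : ℕ) :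
    (N ⊔ Subgroup.closure (Set.range fun σ : E ≃ₐ[M] E => σ ^ p)).index ∣
      (powMonoidHom p : ClassGroup (𝓞 M) →* ClassGroup (𝓞 M)).range.index := by
  classical
  set N' : Subgroup (E ≃ₐ[M] E) := N ⊔ Subgroup.closure (Set.range fun σ : E ≃ₐ[M] E => σ ^ p) with hN'
  have hcomm' : ⁅(⊤ : Subgroup (E ≃ₐ[M] E)), ⊤⁆ ≤ N' := hcomm.trans le_sup_left
  haveI : N'.Normal := normal_of_commutator_le'' hcomm'
  set F : IntermediateField M E := IntermediateField.fixedField N' with hF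
  haveI : IsGalois M F := IsGalois.of_fixedField_normal_subgroup N'
  have hFdeg : Module.finrank M F = N'.index := by
    have h1 := Module.finrank_mul_finrank M F E
    rw [hF, IntermediateField.finrank_fixedField_eq_card N'] at h1
    have h2 : N'.index * Nat.card N' = Nat.card (E ≃ₐ[M] E) := N'.index_mul_card
    rw [IsGalois.card_aut_eq_finrank] at h2
    rw [hF]
    exact Nat.eq_of_mul_eq_mul_right Nat.card_pos (h1.trans h2.symm)
  -- `Gal(F/M) ≅ G/N'` is commutative and killed by `p`
  haveI : IsAbelianGalois M F := by
    refine { is_comm := ⟨fun x y => ?_⟩ }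
    obtain ⟨x', rfl⟩ := (IsGalois.normalAutEquivQuotient N').surjective x
    obtain ⟨y', rfl⟩ := (IsGalois.normalAutEquivQuotient N').surjective y
    rw [← map_mul, ← map_mul]
    congr 1
    have hc : IsMulCommutative ((E ≃ₐ[M] E) ⧸ N') := by
      rw [Subgroup.Normal.quotient_commutative_iff_commutator_le, commutator_def]
      exact hcomm'
    exact hc.is_comm.comm x' y'
  have hexp : ∀ x : F ≃ₐ[M] F, x ^ p = 1 := by
    intro x
    obtain ⟨x', rfl⟩ := (IsGalois.normalAutEquivQuotient N').surjective x
    obtain ⟨σ, rfl⟩ := QuotientGroup.mk_surjective x'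
    rw [← map_pow, ← QuotientGroup.mk_pow, (QuotientGroup.eq_one_iff _).mpr, map_one]
    exact Subgroup.mem_sup_right (Subgroup.subset_closure ⟨σ, rfl⟩)
  haveI : IsUnramifiedAtInfinitePlaces M F :=
    isUnramifiedAtInfinitePlaces_of_algHom (IsScalarTower.toAlgHom M F E)
  have hunrF : ∀ v : HeightOneSpectrum (𝓞 M), Algebra.IsUnramifiedIn (𝓞 F) v.asIdeal := by
    intro v q hq hqv
    haveI := hq
    have hq0 : q ≠ ⊥ := by
      intro h0
      apply v.ne_bot
      rw [hqv.over, h0, Ideal.under_def, Ideal.comap_bot_of_injective _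
        (FaithfulSMul.algebraMap_injective (𝓞 M) (𝓞 F))]
    haveI : q.IsMaximal := hq.isMaximal hq0
    obtain ⟨Q, hQmax, hQq⟩ := Ideal.exists_maximal_ideal_liesOver_of_isIntegral (S := 𝓞 E) q
    haveI := hQmax
    have hq' : q = Q.under (𝓞 F) := hQq.over
    subst hq'
    rw [isUnramifiedAt_under_iff_inertia_le' F Q, hF, IntermediateField.fixingSubgroup_fixedField]
    exact (hIN Q).trans le_sup_left
  have hdvd := finrank_dvd_index_range_pow_of_pow_eq_one (K := M) F hunrF p hexp
  rwa [hFdeg] at hdvd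

end Literature.NumberTheory.NumberFields

end
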